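import Summits.ResolutionOfSingularities.ResolutionOfSingularities.Theorems.EquisingularLiftEquisingularLiftNatEquinodalNodeRegularCore
import Literature.AlgebraicGeometry.Resolution.KollarMaxContactChartsFieldChange
import HarnessLib

/-!
# [OURS · L1 W4.5(b) · EL♮(3) · door ν4, brick N-0 (JINIT at `RD := RPlus`), piece (N0-c), part 2] NODE-REGULARITY RING CORE — TAYLOR
# `f(α) = 0 ∧ ∇f(α) = 0 ⇒ f ∈ 𝔪_α²`; the node chart's cubic remainder; the two PACKAGED regularity criteria for the consumer

res-L1-w45b-nose-w1 g4 (WIDTH seat D-0157 DOOR 1).  Continues …NatEquinodalNodeRegularCore (§1 derivations vs the symbolic square, §2 the node, Nakayama).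
Here §3: first-order Taylor in `MvPolynomial` (every characteristic), the decomposition `g = a x₀² + b x₀x₁ + c x₁² + h`, `h ∈ (x₀,x₁)³` of a chart
polynomial with vanishing constant/linear coefficients (the four outputs of ✓ `nodeChart_hypotheses` ARE the inputs of §2), and the two criteria the
scheme-level proof of «`V(𝓦₀)` regular off the node sections» calls: `nodeChart_isRegularLocalRing_quotient` (near a marked node, off the section) and
`isRegularLocalRing_quotient_of_eval_pderiv_map_ne_zero` (near a regular closed point of the reduced special fibre), both concluding
`O[x]_𝔭 / (G)` regular from `O[x]_𝔭` regular.  Pure algebra; DEF-FREE; no `sorry`; standard axioms.  `--supports stmt-ResolutionOfSingularities-20148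
--as helper`, counted 0.  EL♮(3) is NOT proved; resolution in positive characteristic is NOT proved.
-/

set_option linter.dupNamespace false -- mandated namespace `Summit.<Summit>.<Problem>` of this single-conjunct summit

noncomputable section

open IsLocalRing MvPolynomial

namespace Summit.ResolutionOfSingularities.ResolutionOfSingularities.Cruxes.EquisingularLiftNat.Sections.Equinodal.NodeReg

/-! ## §3 Taylor: `f(α) = 0 ∧ ∇f(α) = 0 ⇒ f ∈ 𝔪_α²`, and the node chart's cubic remainder -/

section Taylor

variable {K : Type*} [CommRing K] {σ : Type*}

/-- A finitely supported function of degree one is a `single i 1`. [folklore] -/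
theorem _root_.Finsupp.exists_eq_single_one_of_degree_eq_one (x : σ →₀ ℕ) (hx : x.degree = 1) :
    ∃ i, x = Finsupp.single i 1 := by
  classical
  have hx0 : x ≠ 0 := by rintro rfl; simp at hx
  obtain ⟨i, hi⟩ := Finsupp.ne_iff.mp hx0
  simp only [Finsupp.coe_zero, Pi.zero_apply] at hi
  refine ⟨i, ?_⟩
  have hle : x i ≤ x.degree := Finsupp.le_degree i x
  rw [hx] at hle
  have hxi : x i = 1 := by omega
  -- `x = single i (x i) + x.erase i`, and the rest has degree `0`
  have hsplit : x = Finsupp.single i (x i) + x.erase i := (Finsupp.single_add_erase i x).symm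
  have hdeg : (Finsupp.single i (x i) + x.erase i).degree = 1 := by rw [← hsplit]; exact hx
  rw [map_add, Finsupp.degree_single, hxi] at hdeg
  have herase : (x.erase i).degree = 0 := by omega
  rw [Finsupp.degree_eq_zero_iff] at herase
  rw [hsplit, herase, add_zero, hxi]

/-- Translation commutes with partial derivatives: `∂_i (f(x + α)) = (∂_i f)(x + α)`. [folklore] -/
theorem pderiv_aeval_X_add_C [DecidableEq σ] (α : σ → K) (i : σ) (f : MvPolynomial σ K) :
    pderiv i (aeval (fun j => X j + C (α j)) f) = aeval (fun j => X j + C (α j)) (pderiv i f) := by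
  induction f using MvPolynomial.induction_on with
  | C a => simp
  | add p q hp hq => simp only [map_add, hp, hq]
  | mul_X p s hp =>
    rw [map_mul, aeval_X]
    simp only [Derivation.leibniz, smul_eq_mul, map_add, map_mul, aeval_X, hp, pderiv_C, add_zero, pderiv_X]
    by_cases h : s = i
    · subst h; simp
    · simp [Pi.single_eq_of_ne h]

/-- Evaluating the translate `f(x + α)` at `0` is evaluating `f` at `α`. [folklore] -/
theorem eval_zero_aeval_X_add_C (α : σ → K) (f : MvPolynomial σ K) :
    eval (0 : σ → K) (aeval (fun j => X j + C (α j)) f) = eval α f := by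
  induction f using MvPolynomial.induction_on with
  | C a => simp
  | add p q hp hq => simp only [map_add, hp, hq]
  | mul_X p s hp => rw [map_mul, map_mul, aeval_X, map_mul, hp, eval_X]; simp

/-- Translating back: `(f(x + α))(x − α) = f`. [folklore] -/
theorem aeval_X_sub_C_aeval_X_add_C (α : σ → K) (f : MvPolynomial σ K) :
    aeval (fun j => X j - C (α j)) (aeval (fun j => X j + C (α j)) f) = f := by
  induction f using MvPolynomial.induction_on with
  | C a => simp
  | add p q hp hq => simp only [map_add, hp, hq]
  | mul_X p s hp => rw [map_mul, map_mul, aeval_X, hp, map_add, aeval_X, aeval_C]; simp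

/-- **TAYLOR TO FIRST ORDER**: if `f(α) = 0` and all partials `∂_i f(α) = 0`, then `f ∈ (x_i − α_i : i)²` — every characteristic (the linear
Taylor coefficients of a polynomial ARE its formal partials).  Contrapositive use: at a regular rational point of a plane curve `V(f)` some
partial does not vanish. [folklore] -/
theorem mem_sq_of_eval_eq_zero_of_eval_pderiv_eq_zero [Fintype σ] [DecidableEq σ] (α : σ → K) (f : MvPolynomial σ K)
    (h0 : eval α f = 0) (h1 : ∀ i, eval α (pderiv i f) = 0) :
    f ∈ Ideal.span (Set.range fun i : σ => X i - C (α i)) ^ 2 := by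
  -- the translate lies in `(x)²`
  have hg2 : aeval (fun j => X j + C (α j)) f ∈ idealOfVars σ K ^ 2 := by
    rw [mem_pow_idealOfVars_iff']
    intro x hx
    have hx' : x.degree = 0 ∨ x.degree = 1 := by omega
    rcases hx' with hx0 | hx1
    · rw [Finsupp.degree_eq_zero_iff] at hx0
      subst hx0
      have := eval_zero_aeval_X_add_C α f
      rw [h0, eval_zero, constantCoeff_eq] at this
      exact this
    · obtain ⟨i, rfl⟩ := x.exists_eq_single_one_of_degree_eq_one hx1
      have h := eval_zero_aeval_X_add_C α (pderiv i f)
      rw [h1 i, ← pderiv_aeval_X_add_C, eval_zero, constantCoeff_eq, coeff_pderiv] at h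
      simpa using h
  -- translate back
  rw [← aeval_X_sub_C_aeval_X_add_C α f]
  have hmap : (idealOfVars σ K ^ 2).map (aeval (fun j => X j - C (α j)) : MvPolynomial σ K →ₐ[K] MvPolynomial σ K) =
      Ideal.span (Set.range fun i : σ => X i - C (α i)) ^ 2 := by
    rw [Ideal.map_pow, idealOfVars, Ideal.map_span, ← Set.range_comp]
    congr 2
    ext i
    simp
  rw [← hmap]
  exact Ideal.mem_map_of_mem _ hg2

/-- On two variables the ideal of the variables is `(x₀, x₁)`. -/
theorem idealOfVars_fin_two : idealOfVars (Fin 2) K = Ideal.span {X 0, X 1} := by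
  rw [idealOfVars]
  congr 1
  ext p
  simp only [Set.mem_range, Set.mem_insert_iff, Set.mem_singleton_iff]
  constructor
  · rintro ⟨i, rfl⟩; fin_cases i <;> simp
  · rintro (rfl | rfl)
    · exact ⟨0, rfl⟩
    · exact ⟨1, rfl⟩

/-- **THE NODE CHART'S CUBIC REMAINDER**: a two-variable polynomial with vanishing constant and linear coefficients is its quadratic part
`a x₀² + b x₀x₁ + c x₁²` plus a remainder in `(x₀, x₁)³` — the shape `G = a u² + b uv + c v² + h`, `h ∈ (u,v)³` of §2 (and of `SplitNodeAt`),
with `a, b, c` the degree-two COEFFICIENTS read by ✓ `nodeChart_hypotheses`. [folklore] -/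
theorem sub_quadratic_mem_cube (g : MvPolynomial (Fin 2) K) (h00 : coeff 0 g = 0) (h10 : coeff (Finsupp.single 0 1) g = 0)
    (h01 : coeff (Finsupp.single 1 1) g = 0) :
    g - (C (coeff (Finsupp.single 0 2) g) * X 0 ^ 2 + C (coeff (Finsupp.single 0 1 + Finsupp.single 1 1) g) * X 0 * X 1 +
        C (coeff (Finsupp.single 1 2) g) * X 1 ^ 2) ∈ Ideal.span {(X 0 : MvPolynomial (Fin 2) K), X 1} ^ 3 := by
  classical
  set q : MvPolynomial (Fin 2) K := C (coeff (Finsupp.single 0 2) g) * X 0 ^ 2 +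
    C (coeff (Finsupp.single 0 1 + Finsupp.single 1 1) g) * X 0 * X 1 + C (coeff (Finsupp.single 1 2) g) * X 1 ^ 2 with hqdef
  have hq : q = (monomial (Finsupp.single 0 2) (coeff (Finsupp.single 0 2) g) : MvPolynomial (Fin 2) K) +
      monomial (Finsupp.single 0 1 + Finsupp.single 1 1) (coeff (Finsupp.single 0 1 + Finsupp.single 1 1) g) +
      monomial (Finsupp.single 1 2) (coeff (Finsupp.single 1 2) g) := by
    rw [hqdef]
    simp only [X, monomial_pow, C_mul_monomial, monomial_mul, one_pow, mul_one, Finsupp.smul_single, smul_eq_mul]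
  rw [hq, ← idealOfVars_fin_two, mem_pow_idealOfVars_iff']
  intro x hx
  -- write `x = single 0 i + single 1 j` with `i + j < 3`
  have hsplit : x = Finsupp.single 0 (x 0) + Finsupp.single 1 (x 1) := by
    ext k; fin_cases k <;> simp
  have hdeg : x.degree = x 0 + x 1 := by
    rw [hsplit, map_add, Finsupp.degree_single, Finsupp.degree_single]
    simp
  rw [hdeg] at hx
  have key : ∀ (m : Fin 2 →₀ ℕ), (m = x ↔ m 0 = x 0 ∧ m 1 = x 1) := by
    intro m
    constructor
    · rintro rfl; exact ⟨rfl, rfl⟩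
    · rintro ⟨h0, h1⟩; ext k; fin_cases k
      · simpa using h0
      · simpa using h1
  have hx' : x 0 = 0 ∧ x 1 = 0 ∨ x 0 = 1 ∧ x 1 = 0 ∨ x 0 = 0 ∧ x 1 = 1 ∨ x 0 = 2 ∧ x 1 = 0 ∨ x 0 = 1 ∧ x 1 = 1 ∨
      x 0 = 0 ∧ x 1 = 2 := by omega
  have hg : ∀ m : Fin 2 →₀ ℕ, coeff m g = coeff (Finsupp.single 0 (m 0) + Finsupp.single 1 (m 1)) g := by
    intro m; congr 1; ext k; fin_cases k <;> simp
  simp only [coeff_sub, coeff_add, coeff_monomial, key, Finsupp.single_apply, Finsupp.coe_add, Pi.add_apply]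
  simp only [Fin.isValue, ↓reduceIte, one_ne_zero, zero_ne_one, add_zero, zero_add]
  rw [hg x]
  rcases hx' with ⟨h0, h1⟩ | ⟨h0, h1⟩ | ⟨h0, h1⟩ | ⟨h0, h1⟩ | ⟨h0, h1⟩ | ⟨h0, h1⟩ <;> simp only [h0, h1] <;> norm_num <;> assumption

/-- **THE NODE CHART, PACKAGED FOR THE CONSUMER.**  `g ∈ O[x₀, x₁]` with vanishing constant and linear coefficients and `b² − 4ac` a unit for its
degree-two coefficients (= the four outputs of ✓ `nodeChart_hypotheses`); `𝔪` a prime containing `x₀, x₁` (the node point); `𝔭 ⊆ 𝔪` a prime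
containing `g` but not both `x₀, x₁` (a point of `V(g)` near the node, OFF the section).  If `O[x]_𝔭` is regular then `O[x]_𝔭 / (g)` is regular of
dimension one less — via `∂/∂x₀, ∂/∂x₁` and §§1–2. [folklore; every characteristic] -/
theorem nodeChart_isRegularLocalRing_quotient {O : Type*} [CommRing O] {Rₚ : Type*} [CommRing Rₚ] [Algebra (MvPolynomial (Fin 2) O) Rₚ]
    (g : MvPolynomial (Fin 2) O) (h00 : coeff 0 g = 0) (h10 : coeff (Finsupp.single 0 1) g = 0) (h01 : coeff (Finsupp.single 1 1) g = 0)
    (hdisc : IsUnit (coeff (Finsupp.single 0 1 + Finsupp.single 1 1) g ^ 2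
      - 4 * coeff (Finsupp.single 0 2) g * coeff (Finsupp.single 1 2) g))
    {𝔪 𝔭 : Ideal (MvPolynomial (Fin 2) O)} [𝔪.IsPrime] [𝔭.IsPrime] [IsRegularLocalRing Rₚ] [IsLocalization.AtPrime Rₚ 𝔭]
    (hu : (X 0 : MvPolynomial (Fin 2) O) ∈ 𝔪) (hv : (X 1 : MvPolynomial (Fin 2) O) ∈ 𝔪) (h𝔭𝔪 : 𝔭 ≤ 𝔪) (hg : g ∈ 𝔭)
    (hsec : ¬ ((X 0 : MvPolynomial (Fin 2) O) ∈ 𝔭 ∧ (X 1 : MvPolynomial (Fin 2) O) ∈ 𝔭)) :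
    IsRegularLocalRing (Rₚ ⧸ Ideal.span {algebraMap (MvPolynomial (Fin 2) O) Rₚ g}) ∧
      ringKrullDim (Rₚ ⧸ Ideal.span {algebraMap (MvPolynomial (Fin 2) O) Rₚ g}) + 1 = ringKrullDim Rₚ := by
  classical
  set a := coeff (Finsupp.single 0 2) g
  set b := coeff (Finsupp.single 0 1 + Finsupp.single 1 1) g
  set c := coeff (Finsupp.single 1 2) g
  set h := g - (C a * X 0 ^ 2 + C b * X 0 * X 1 + C c * X 1 ^ 2) with hh
  have hmem : h ∈ Ideal.span {(X 0 : MvPolynomial (Fin 2) O), X 1} ^ 3 := sub_quadratic_mem_cube g h00 h10 h01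
  have hG : g = C a * X 0 ^ 2 + C b * X 0 * X 1 + C c * X 1 ^ 2 + h := by rw [hh]; ring
  have hdisc' : IsUnit ((C b : MvPolynomial (Fin 2) O) ^ 2 - 4 * C a * C c) := by
    have : (C b : MvPolynomial (Fin 2) O) ^ 2 - 4 * C a * C c = C (b ^ 2 - 4 * a * c) := by
      simp only [map_sub, map_pow, map_mul, map_ofNat]
    rw [this]; exact hdisc.map C
  have h1u : pderiv 0 (X 0 : MvPolynomial (Fin 2) O) = 1 := by simp
  have h1v : pderiv 0 (X 1 : MvPolynomial (Fin 2) O) = 0 := by simp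
  have h2u : pderiv 1 (X 0 : MvPolynomial (Fin 2) O) = 0 := by simp
  have h2v : pderiv 1 (X 1 : MvPolynomial (Fin 2) O) = 1 := by simp
  rw [hG] at hg ⊢
  exact node_isRegularLocalRing_quotient (pderiv 0) (pderiv 1) (X 0) (X 1) (C a) (C b) (C c) h h1u h1v h2u h2v hmem hdisc'
    hu hv h𝔭𝔪 hg hsec

/-- **AT A REGULAR RATIONAL POINT OF `V(f)` SOME PARTIAL DOES NOT VANISH** (Jacobian criterion, easy direction, every characteristic): `𝔪` a prime of
`K[x]` containing all `x_i − α_i`, `K[x]_𝔪` regular, `f(α) = 0`, `f/1 ≠ 0` and `K[x]_𝔪 / (f)` regular ⇒ `∂_i f (α) ≠ 0` for some `i` (else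
`f ∈ 𝔪_α² ⊆ 𝔪²`, contradicting Literature ✓ `notMem_sq_of_isRegularLocalRing_quotient`, Matsumura 14.2). [folklore] -/
theorem exists_eval_pderiv_ne_zero_of_isRegularLocalRing_quotient [Fintype σ] [DecidableEq σ] {Rₚ : Type*} [CommRing Rₚ]
    [Algebra (MvPolynomial σ K) Rₚ] {𝔪 : Ideal (MvPolynomial σ K)} [𝔪.IsPrime] [IsRegularLocalRing Rₚ] [IsLocalization.AtPrime Rₚ 𝔪]
    (α : σ → K) (hα : ∀ i, X i - C (α i) ∈ 𝔪) (f : MvPolynomial σ K) (h0 : eval α f = 0) (hf𝔪 : f ∈ 𝔪)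
    (hf0 : algebraMap (MvPolynomial σ K) Rₚ f ≠ 0) [IsRegularLocalRing (Rₚ ⧸ Ideal.span {algebraMap (MvPolynomial σ K) Rₚ f})] :
    ∃ i, eval α (pderiv i f) ≠ 0 := by
  by_contra hcon
  simp only [not_exists, not_not] at hcon
  have hmem := mem_sq_of_eval_eq_zero_of_eval_pderiv_eq_zero α f h0 hcon
  have hle : Ideal.span (Set.range fun i : σ => X i - C (α i)) ≤ 𝔪 := by
    rw [Ideal.span_le]; rintro _ ⟨i, rfl⟩; exact hα i
  have hsq : algebraMap (MvPolynomial σ K) Rₚ f ∈ maximalIdeal Rₚ ^ 2 := by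
    rw [← IsLocalization.AtPrime.map_eq_maximalIdeal 𝔪 Rₚ, ← Ideal.map_pow]
    exact Ideal.mem_map_of_mem _ (Ideal.pow_right_mono hle 2 hmem)
  exact Literature.AlgebraicGeometry.Resolution.notMem_sq_of_isRegularLocalRing_quotient
    ((IsLocalization.AtPrime.to_map_mem_maximal_iff Rₚ 𝔪 f).mpr hf𝔪) hf0 hsq

/-- **… PACKAGED FOR THE CONSUMER (regular point of the reduced special fibre).**  `G ∈ O[x]`, `θ : O → k` (the residue map), `α̃` an `O`-lift of the
rational point `α = θ ∘ α̃`; if some partial of the reduction `map θ G` does not vanish at `α`, then `∂_i G ∉ 𝔪` for every prime `𝔪` killed by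
`F ↦ θ (F(α̃))` — so for every prime `𝔭 ⊆ 𝔪` containing `G` with `O[x]_𝔭` regular, `O[x]_𝔭 / (G)` is regular of dimension one less (§1). [folklore] -/
theorem isRegularLocalRing_quotient_of_eval_pderiv_map_ne_zero [Fintype σ] [DecidableEq σ] {O k : Type*} [CommRing O] [CommRing k]
    (θ : O →+* k) {Rₚ : Type*} [CommRing Rₚ] [Algebra (MvPolynomial σ O) Rₚ] (G : MvPolynomial σ O) (αO : σ → O) {i : σ}
    (hi : eval (fun j => θ (αO j)) (pderiv i (MvPolynomial.map θ G)) ≠ 0)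
    {𝔪 𝔭 : Ideal (MvPolynomial σ O)} [𝔭.IsPrime] (h𝔪 : ∀ F ∈ 𝔪, θ (eval αO F) = 0) [IsRegularLocalRing Rₚ] [IsLocalization.AtPrime Rₚ 𝔭]
    (h𝔭𝔪 : 𝔭 ≤ 𝔪) (hG : G ∈ 𝔭) :
    IsRegularLocalRing (Rₚ ⧸ Ideal.span {algebraMap (MvPolynomial σ O) Rₚ G}) ∧
      ringKrullDim (Rₚ ⧸ Ideal.span {algebraMap (MvPolynomial σ O) Rₚ G}) + 1 = ringKrullDim Rₚ := by
  have key : ∀ q : MvPolynomial σ O, θ (eval αO q) = eval (fun j => θ (αO j)) (MvPolynomial.map θ q) := fun q => by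
    induction q using MvPolynomial.induction_on with
    | C a => simp
    | add p q hp hq => simp [hp, hq]
    | mul_X p s hp => simp [hp]
  refine isRegularLocalRing_quotient_of_derivation_not_mem 𝔭 (pderiv i) hG fun hmem => hi ?_
  rw [pderiv_map, ← key]
  exact h𝔪 _ (h𝔭𝔪 hmem)

end Taylor

end Summit.ResolutionOfSingularities.ResolutionOfSingularities.Cruxes.EquisingularLiftNat.Sections.Equinodal.NodeReg

end
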